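import Mathlib
import HarnessLib
import Summits.Ventures.LatticeQCDFlow.Exactness.QuasiStaticDissipation
import Summits.Ventures.LatticeQCDFlow.Scaling.StochasticBudgets

/-!
# The quasi-static floor is the perfect-relaxation value of the measured `D_KL = ⟨W⟩ − ΔF`

HONEST FRAMING: exact (Metropolis-corrected) sampling algorithms for lattice gauge theory;
figures of merit are autocorrelation/cost numbers at stated couplings and volumes; no
continuum-physics claim.

Venture `LatticeQCDFlow` (cell pub-lqcd), topic `Exactness`, FANOUT row 8 (s0-cpn-nemc, GEN-4).
OUR WORK (elementary finite sums), nothing cited as a fact.  Bridges row 8's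
`Exactness/QuasiStaticDissipation.lean` (`qsDissipation`: the quasi-static cost
`Σ_k [(c_{k+1} − c_k)⟨D⟩_{c_k} − (F(c_{k+1}) − F(c_k))]` of the stepwise linear protocol) to the
theory seat's path-space objects in `Scaling/StochasticFlows.lean` / `Scaling/StochasticBudgets.lean`
(`pathLaw`, `revPathLaw`, `work`, `kl_path_eq_dissipation : D(P_F ‖ P_R) = ⟨W⟩_F − ΔF`):

* `klFin_gibbsLaw_eq` — `D(π_S ‖ π_T) = ⟨T − S⟩_S − (F_T − F_S)` for any two actions (the
  bookkeeping behind the one-switch second law `freeEnergy_sub_le_gibbsMean`), and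
  `klFin_gibbsLaw_linAction`, `qsDissipation_eq_sum_klFin` — **the quasi-static cost is the sum of
  the relative entropies between consecutive equilibrium laws**, `KL_qs = Σ_k D(π_{c_k} ‖ π_{c_{k+1}})`;
* `sum_blockProd_mul_apply` — a one-block observable under a product law;
* `meanWork_perfect` — under PERFECT relaxation (every layer resamples exactly from its Gibbs
  law, the tree's `fun k _ y => gibbsLaw (S k.succ) y`) the mean work is `Σ_k ⟨S_{k+1} − S_k⟩_{S_k}`;
* `kl_path_perfect_eq_sum` — hence `D(P_F ‖ P_R) = Σ_k D(π_k ‖ π_{k+1})` for ANY protocol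
  `S_0, …, S_n` with perfect relaxation (the KL twin of T2-W `ess_perfect_relaxation`);
* **`kl_path_perfect_eq_qsDissipation`** — for the linear family `S_{c_k} = S₀ + c_k D`:
  `D(P_F ‖ P_R) = KL_qs`.

Reading (HOME/s0-cpn-nemc/RESULTS.md §7(c)/§8): the `D̃_KL = ⟨W⟩ − ΔF` that Bonanno–Nada–Vadacchino
2024 print and that the S0-D2 reproduction measures IS `D(P_F ‖ P_R)` (`kl_path_eq_dissipation`,
any kernels); its value in the limit of arbitrarily much relaxation per step is EXACTLY `KL_qs`
(this file), which `Exactness/QuasiStaticSecondOrder.lean` pins to `(⟨D⟩_0 − ⟨D⟩_1)/(2 n_step)`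
up to a certified `O(n_step⁻²)` — the 'floor' `12.35 · L_d / n_step` at (N, β, L) = (21, 0.7, 114).
NOT claimed: monotonicity of `D(P_F ‖ P_R)` in the amount of relaxation (a property of the kernels).
-/

namespace Summit.Ventures.LatticeQCDFlow.Exactness

open Finset
open Literature.Probability.MarkovChains (IsRowStochastic)
open Summit.Ventures.LatticeQCDFlow.Theory2

variable {X : Type*} [Fintype X]

/-! ## Relative entropy between two Gibbs laws -/

/-- `D(π_S ‖ π_T) = ⟨T − S⟩_S − (F_T − F_S)`. [folklore] -/
theorem klFin_gibbsLaw_eq [Nonempty X] (S T : X → ℝ) :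
    klFin (gibbsLaw S) (gibbsLaw T)
      = gibbsMean S (fun x => T x - S x) - (freeEnergy T - freeEnergy S) := by
  have hZS := partitionFn_pos S
  have hZT := partitionFn_pos T
  have hlog : ∀ x, Real.log (gibbsLaw S x / gibbsLaw T x)
      = (T x - S x) + (freeEnergy S - freeEnergy T) := by
    intro x
    unfold gibbsLaw freeEnergy
    rw [Real.log_div (div_pos (Real.exp_pos _) hZS).ne' (div_pos (Real.exp_pos _) hZT).ne',
      Real.log_div (Real.exp_pos _).ne' hZS.ne', Real.log_div (Real.exp_pos _).ne' hZT.ne',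
      Real.log_exp, Real.log_exp]
    ring
  unfold klFin gibbsMean
  simp_rw [hlog]
  simp only [mul_add, sum_add_distrib, ← sum_mul, sum_gibbsLaw, one_mul]
  ring

/-- For the linear family: `D(π_a ‖ π_b) = (b − a)⟨D⟩_a − (F b − F a)` — the quasi-static cost of
the switch `a → b` (`qsDissipation`'s summand). -/
theorem klFin_gibbsLaw_linAction [Nonempty X] (S₀ D : X → ℝ) (a b : ℝ) :
    klFin (gibbsLaw (linAction S₀ D a)) (gibbsLaw (linAction S₀ D b))
      = (b - a) * meanD S₀ D a - (linFreeEnergy S₀ D b - linFreeEnergy S₀ D a) := by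
  rw [klFin_gibbsLaw_eq, gibbsMean_linAction_sub]
  rfl

/-- **`KL_qs = Σ_k D(π_{c_k} ‖ π_{c_{k+1}})`.** -/
theorem qsDissipation_eq_sum_klFin [Nonempty X] (S₀ D : X → ℝ) (c : ℕ → ℝ) (n : ℕ) :
    qsDissipation S₀ D c n = ∑ k ∈ range n,
      klFin (gibbsLaw (linAction S₀ D (c k))) (gibbsLaw (linAction S₀ D (c (k + 1)))) := by
  unfold qsDissipation
  exact sum_congr rfl (fun k _ => (klFin_gibbsLaw_linAction S₀ D (c k) (c (k + 1))).symm)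

/-! ## Perfect relaxation: mean work and path relative entropy -/

/-- Expectation of a one-block observable under a product law with normalised blocks:
`Σ_φ (Π_j q_j(φ_j)) g(φ_i) = Σ_z q_i(z) g(z)`. [folklore] -/
theorem sum_blockProd_mul_apply {m : ℕ} {Z : Type*} [Fintype Z] (qb : Fin m → Z → ℝ)
    (hq1 : ∀ i, ∑ z, qb i z = 1) (i : Fin m) (g : Z → ℝ) :
    ∑ φ, blockProd qb φ * g (φ i) = ∑ z, qb i z * g z := by
  classical
  have key : ∀ φ : Fin m → Z, blockProd qb φ * g (φ i)
      = blockProd (Function.update qb i (fun z => qb i z * g z)) φ := by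
    intro φ
    unfold blockProd
    have h1 : ∀ j, Function.update qb i (fun z => qb i z * g z) j (φ j)
        = Function.update (fun j => qb j (φ j)) i (qb i (φ i) * g (φ i)) j := by
      intro j
      by_cases hj : j = i
      · rw [hj]; simp
      · simp [hj]
    simp_rw [h1]
    rw [prod_update_of_mem (mem_univ i),
      prod_eq_mul_prod_sdiff_singleton_of_mem (mem_univ i) (fun j => qb j (φ j))]
    ring
  simp_rw [key]
  rw [sum_blockProd]
  have h2 : ∀ j, ∑ z, Function.update qb i (fun z => qb i z * g z) j z
      = Function.update (fun _ : Fin m => (1:ℝ)) i (∑ z, qb i z * g z) j := by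
    intro j
    by_cases hj : j = i
    · rw [hj]; simp
    · simp [hj, hq1 j]
  simp_rw [h2]
  rw [prod_update_of_mem (mem_univ i)]
  simp

/-- **Mean work under perfect relaxation** is the left Riemann-type sum `Σ_k ⟨S_{k+1} − S_k⟩_{S_k}`
(the switch `k → k+1` is applied to a configuration distributed EXACTLY as `π_{S_k}`). -/
theorem meanWork_perfect [Nonempty X] {n : ℕ} (S : Fin (n + 1) → X → ℝ) :
    ∑ ω, pathLaw (gibbsLaw (S 0)) (fun (k : Fin n) (_ : X) (y : X) => gibbsLaw (S k.succ) y) ω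
        * work S ω
      = ∑ k : Fin n, gibbsMean (S k.castSucc) (fun x => S k.succ x - S k.castSucc x) := by
  simp_rw [pathLaw_perfect]
  unfold work gibbsMean
  simp_rw [mul_sum]
  rw [sum_comm]
  exact sum_congr rfl (fun k _ =>
    sum_blockProd_mul_apply (fun i => gibbsLaw (S i)) (fun i => sum_gibbsLaw (S i)) k.castSucc
      (fun x => S k.succ x - S k.castSucc x))

/-- **Path relative entropy under perfect relaxation** (KL twin of T2-W): for any protocol
`S_0, …, S_n` whose layers resample exactly from their Gibbs laws,
`D(P_F ‖ P_R) = Σ_k D(π_{S_k} ‖ π_{S_{k+1}})`. -/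
theorem kl_path_perfect_eq_sum [Nonempty X] {n : ℕ} (S : Fin (n + 1) → X → ℝ) :
    klFin (pathLaw (gibbsLaw (S 0)) (fun (k : Fin n) (_ : X) (y : X) => gibbsLaw (S k.succ) y))
        (revPathLaw S (fun k _ y => gibbsLaw (S k.succ) y))
      = ∑ k : Fin n, klFin (gibbsLaw (S k.castSucc)) (gibbsLaw (S k.succ)) := by
  have hP : ∀ k : Fin n, IsRowStochastic (fun (_ : X) (y : X) => gibbsLaw (S k.succ) y) :=
    fun k => ⟨fun _ y => (gibbsLaw_pos _ y).le, fun _ => sum_gibbsLaw _⟩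
  have hPpos : ∀ (k : Fin n) (x y : X), 0 < (fun (_ : X) (y : X) => gibbsLaw (S k.succ) y) x y :=
    fun k _ y => gibbsLaw_pos _ y
  rw [kl_path_eq_dissipation S _ hP hPpos, meanWork_perfect]
  simp_rw [klFin_gibbsLaw_eq]
  have h1 := Fin.sum_univ_castSucc (fun i => freeEnergy (S i))
  have h2 := Fin.sum_univ_succ (fun i => freeEnergy (S i))
  have hlog : Real.log (partitionFn (S (Fin.last n)) / partitionFn (S 0))
      = -(freeEnergy (S (Fin.last n)) - freeEnergy (S 0)) := by
    unfold freeEnergy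
    rw [Real.log_div (partitionFn_pos _).ne' (partitionFn_pos _).ne']
    ring
  have h3 : ∑ k : Fin n, (freeEnergy (S k.succ) - freeEnergy (S k.castSucc))
      = freeEnergy (S (Fin.last n)) - freeEnergy (S 0) := by
    rw [sum_sub_distrib]
    linarith
  rw [hlog, sum_sub_distrib, h3]
  ring

/-- **`D(P_F ‖ P_R) = KL_qs` for the linear defect family with perfect relaxation.**  Along the
grid `c 0, …, c n`, with `S_k = S₀ + c_k • D` and every layer resampling exactly from `π_{c_{k+1}}`,
the forward path relative entropy — `= ⟨W⟩ − ΔF`, the printed `D̃_KL` — equals `qsDissipation`. -/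
theorem kl_path_perfect_eq_qsDissipation [Nonempty X] (S₀ D : X → ℝ) (c : ℕ → ℝ) (n : ℕ) :
    klFin (pathLaw (gibbsLaw (linAction S₀ D (c 0)))
            (fun (k : Fin n) (_ : X) (y : X) => gibbsLaw (linAction S₀ D (c (k + 1))) y))
        (revPathLaw (fun k : Fin (n + 1) => linAction S₀ D (c k))
            (fun k _ y => gibbsLaw (linAction S₀ D (c (k + 1))) y))
      = qsDissipation S₀ D c n := by
  have h := kl_path_perfect_eq_sum (fun k : Fin (n + 1) => linAction S₀ D (c k))
  simp only [Fin.val_succ, Fin.val_castSucc, Fin.val_zero] at h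
  rw [h, qsDissipation_eq_sum_klFin]
  exact Fin.sum_univ_eq_sum_range
    (fun k => klFin (gibbsLaw (linAction S₀ D (c k))) (gibbsLaw (linAction S₀ D (c (k + 1))))) n

/-- Corollary (with `qsDissipation_nonneg` / `_uniform_le`): under perfect relaxation the printed
`D̃_KL` of the uniform `n`-step linear protocol lies in `[0, (⟨D⟩_0 − ⟨D⟩_1)/n]`. -/
theorem kl_path_perfect_uniform_le [Nonempty X] (S₀ D : X → ℝ) {n : ℕ} (hn : n ≠ 0) :
    klFin (pathLaw (gibbsLaw (linAction S₀ D ((0 : ℕ) / (n : ℝ))))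
            (fun (k : Fin n) (_ : X) (y : X) => gibbsLaw (linAction S₀ D (((k + 1 : ℕ) : ℝ) / n)) y))
        (revPathLaw (fun k : Fin (n + 1) => linAction S₀ D ((k : ℕ) / (n : ℝ)))
            (fun k _ y => gibbsLaw (linAction S₀ D (((k + 1 : ℕ) : ℝ) / n)) y))
      ≤ (meanD S₀ D 0 - meanD S₀ D 1) / n := by
  have h := kl_path_perfect_eq_qsDissipation S₀ D (fun k => (k : ℝ) / n) n
  simp only [] at h
  rw [h]
  exact qsDissipation_uniform_le S₀ D hn

end Summit.Ventures.LatticeQCDFlow.Exactness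

/-! ## Note added (row 8 GEN-5): monotonicity in the amount of relaxation, typed for lazy layers

The module docstring above says "NOT claimed: monotonicity of `D(P_F ‖ P_R)` in the amount of
relaxation (a property of the kernels)".  For LAZY perfect-relaxation layers `ε·I + (1 − ε)·Π`
it is now a theorem of the tree: `Exactness/LazyRelaxationLagLaw.lean`, `lazyDissipation_mono`
(`D(P_F ‖ P_R)` is non-decreasing in the laziness `ε` along every monotone grid), with the value
at `ε = 0` being this file's `kl_path_perfect_eq_qsDissipation` (`lazyDissipation_zero`,
`kl_path_lazy_eq`) and the value at `ε = 1` the one-switch cost (`lazyDissipation_one`).  General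
(non-lazy) kernels remain unclaimed; `Scaling/PerfectRelaxationCounterexample` shows why some
hypothesis on the layers is needed on the ESS side.
-/
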